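import Summits.Ventures.PercRepro.LemmaBAbstract

/-!
# The abstract Lemma B from a separating two-colouring of the crossing points

Abstract (graph-free) version of `LemmaBBipartite`: for a crossing family `x` and a map
`c : Config S → Setoid (Fin k)`, a **crossing point** is an `ω` with `c ω`, `c ωᶜ` two distinct
cells of `x`. A two-colouring `χ` of the cube is **separating** when crossing points of different
colours have `c (σ ⊔ τ) = ⊤` and `c (σ ⊓ τ) = ⊥`, and every crossing point has a colour different
from its antipode's. Then `crossCount x c ≤ topBotCount c`
(`crossCount_le_topBotCount_of_separating_colouring`): Daykin's inequality
`Finset.le_card_infs_mul_card_sups` on the two colour classes `s` (colour `false`) and `t = sᶜ`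
(colour `true`) gives `|s|² ≤ |goodSet|²`, and `badSet` injects into `s`.

Consequences: (i) the abstract two-cell case (`crossCount_le_topBotCount_of_two_cells`): if only two
cells `x a`, `x b` of the family occur on crossing points, colour by `c ω = x a`; (ii) (paper, not
formalised here) with `χ` the bipartition of the component graph of the middle `c⁻¹(Setoid ∖ {⊤, ⊥})`
this is «bipartite component graph ⇒ abstract Lemma B» (`HOME/proofs/P4-components.md`), which
covers every cube of dimension `≤ 5`; (iii) **Lemma B with a colouring defect** (`crossCount_sq_le_of_colouring`,
`crossCount_le_topBotCount_add_defect`): for an arbitrary antipode-separating two-colouring the same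
Daykin argument gives `crossCount² ≤ (topBotCount + |infDefect|)(topBotCount + |supDefect|)`, the
defects being the non-`{⊤, ⊥}` joins / meets of differently coloured crossing points.
-/

namespace PercRepro

open Finset
open scoped FinsetFamily

section Colouring

variable {S : Type*} [Fintype S] [DecidableEq S] {k r : ℕ}

/-- `ω` is a **crossing point** of `c` for the family `x`: `c ω` and `c ωᶜ` are two distinct
cells of `x` (either order). -/
def IsCrossingPt (x : Fin r → Setoid (Fin k)) (c : Config S → Setoid (Fin k)) (ω : Config S) :
    Prop :=
  ∃ i j : Fin r, i ≠ j ∧ c ω = x i ∧ c ωᶜ = x j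

omit [Fintype S] [DecidableEq S] in
/-- The antipode of a crossing point is a crossing point. -/
theorem IsCrossingPt.compl {x : Fin r → Setoid (Fin k)} {c : Config S → Setoid (Fin k)}
    {ω : Config S} (h : IsCrossingPt x c ω) : IsCrossingPt x c ωᶜ := by
  obtain ⟨i, j, hij, h1, h2⟩ := h
  exact ⟨j, i, hij.symm, h2, by rw [compl_compl]; exact h1⟩

/-- Members of `badSet` are crossing points. -/
theorem isCrossingPt_of_mem_badSet {x : Fin r → Setoid (Fin k)} {c : Config S → Setoid (Fin k)}
    {ω : Config S} (h : ω ∈ badSet x c) : IsCrossingPt x c ω := by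
  classical
  unfold badSet at h
  rw [Finset.mem_filter] at h
  obtain ⟨-, i, j, hij, h1, h2⟩ := h
  exact ⟨i, j, hij.ne, h1, h2⟩

/-- A point and its antipode are never both in `badSet` (the cells are distinct and ordered). -/
theorem not_mem_badSet_compl {x : Fin r → Setoid (Fin k)} (hx : Function.Injective x)
    {c : Config S → Setoid (Fin k)} {ω : Config S} (h : ω ∈ badSet x c) : ωᶜ ∉ badSet x c := by
  classical
  intro h'
  unfold badSet at h h'
  rw [Finset.mem_filter] at h h'
  obtain ⟨-, i, j, hij, h1, h2⟩ := h
  obtain ⟨-, i', j', hij', h1', h2'⟩ := h'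
  rw [compl_compl] at h2'
  have e1 : i = j' := hx (h1.symm.trans h2')
  have e2 : j = i' := hx (h2.symm.trans h1')
  subst e1; subst e2
  exact absurd (hij.trans hij') (lt_irrefl _)

/-- **Abstract Lemma B from a separating two-colouring.** If `χ : Config S → Bool` satisfies
(i) crossing points of different colours have `c (σ ⊔ τ) = ⊤` and `c (σ ⊓ τ) = ⊥`, and
(ii) every crossing point has a colour different from its antipode's, then
`crossCount x c ≤ topBotCount c`. -/
theorem crossCount_le_topBotCount_of_separating_colouring (x : Fin r → Setoid (Fin k))
    (hx : Function.Injective x) (c : Config S → Setoid (Fin k)) (χ : Config S → Bool)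
    (hsep : ∀ σ τ : Config S, IsCrossingPt x c σ → IsCrossingPt x c τ → χ σ ≠ χ τ →
      c (σ ⊔ τ) = ⊤ ∧ c (σ ⊓ τ) = ⊥)
    (hcross : ∀ σ : Config S, IsCrossingPt x c σ → χ σ ≠ χ σᶜ) :
    crossCount x c ≤ topBotCount c := by
  classical
  -- the two colour classes of crossing points
  set s : Finset (Config S) := univ.filter fun σ => IsCrossingPt x c σ ∧ χ σ = false with hs
  set t : Finset (Config S) := univ.filter fun σ => IsCrossingPt x c σ ∧ χ σ = true with ht
  have mem_s : ∀ σ, σ ∈ s ↔ IsCrossingPt x c σ ∧ χ σ = false := by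
    intro σ; rw [hs, Finset.mem_filter]; simp
  have mem_t : ∀ σ, σ ∈ t ↔ IsCrossingPt x c σ ∧ χ σ = true := by
    intro σ; rw [ht, Finset.mem_filter]; simp
  -- colours of antipodes
  have flip_false : ∀ σ, IsCrossingPt x c σ → χ σ = false → χ σᶜ = true := by
    intro σ hσ h
    cases h' : χ σᶜ
    · exact absurd (h.trans h'.symm) (hcross σ hσ)
    · rfl
  have flip_true : ∀ σ, IsCrossingPt x c σ → χ σ = true → χ σᶜ = false := by
    intro σ hσ h
    cases h' : χ σᶜ
    · rfl
    · exact absurd (h.trans h'.symm) (hcross σ hσ)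
  -- `t` is the set of antipodes of `s`
  have hts : t = s.image compl := by
    ext ω
    rw [mem_t, Finset.mem_image]
    constructor
    · rintro ⟨hω, hχ⟩
      exact ⟨ωᶜ, (mem_s ωᶜ).2 ⟨hω.compl, flip_true ω hω hχ⟩, compl_compl ω⟩
    · rintro ⟨σ, hσ, rfl⟩
      obtain ⟨hσ, hχ⟩ := (mem_s σ).1 hσ
      exact ⟨hσ.compl, flip_false σ hσ hχ⟩
  have hcard : t.card = s.card := by
    rw [hts]; exact Finset.card_image_of_injective _ compl_injective
  -- joins land in `goodSet`, meets in its antipode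
  have hsups : s ⊻ t ⊆ goodSet c := by
    intro ρ hρ
    rw [Finset.mem_sups] at hρ
    obtain ⟨σ, hσ, τ, hτ, rfl⟩ := hρ
    obtain ⟨hσ, hχσ⟩ := (mem_s σ).1 hσ
    obtain ⟨hτ, hχτ⟩ := (mem_t τ).1 hτ
    have h1 := hsep σ τ hσ hτ (by rw [hχσ, hχτ]; decide)
    have h2 := hsep σᶜ τᶜ hσ.compl hτ.compl
      (by rw [flip_false σ hσ hχσ, flip_true τ hτ hχτ]; decide)
    unfold goodSet
    rw [Finset.mem_filter]
    refine ⟨Finset.mem_univ _, h1.1, ?_⟩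
    rw [compl_sup]
    exact h2.2
  have hinfs : s ⊼ t ⊆ (goodSet c).image compl := by
    intro ρ hρ
    rw [Finset.mem_infs] at hρ
    obtain ⟨σ, hσ, τ, hτ, rfl⟩ := hρ
    obtain ⟨hσ, hχσ⟩ := (mem_s σ).1 hσ
    obtain ⟨hτ, hχτ⟩ := (mem_t τ).1 hτ
    have h1 := hsep σ τ hσ hτ (by rw [hχσ, hχτ]; decide)
    have h2 := hsep σᶜ τᶜ hσ.compl hτ.compl
      (by rw [flip_false σ hσ hχσ, flip_true τ hτ hχτ]; decide)
    rw [Finset.mem_image]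
    refine ⟨(σ ⊓ τ)ᶜ, ?_, compl_compl _⟩
    unfold goodSet
    rw [Finset.mem_filter, compl_compl, compl_inf]
    exact ⟨Finset.mem_univ _, h2.1, h1.2⟩
  -- Daykin
  have hdk := Finset.le_card_infs_mul_card_sups s t
  have h1 : (s ⊻ t).card ≤ (goodSet c).card := Finset.card_le_card hsups
  have h2 : (s ⊼ t).card ≤ (goodSet c).card :=
    (Finset.card_le_card hinfs).trans Finset.card_image_le
  rw [hcard] at hdk
  have hss : s.card * s.card ≤ (goodSet c).card * (goodSet c).card :=
    hdk.trans (Nat.mul_le_mul h2 h1)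
  have hsg : s.card ≤ (goodSet c).card := Nat.mul_self_le_mul_self_iff.1 hss
  -- `badSet` injects into `s`: send a bad point to its `false`-coloured member
  have hbad : (badSet x c).card ≤ s.card := by
    refine Finset.card_le_card_of_injOn (fun ω => if χ ω = false then ω else ωᶜ) ?_ ?_
    · intro ω hω
      have hω' := isCrossingPt_of_mem_badSet hω
      show (if χ ω = false then ω else ωᶜ) ∈ s
      by_cases h : χ ω = false
      · rw [if_pos h]
        exact (mem_s ω).2 ⟨hω', h⟩
      · rw [if_neg h]
        have h' : χ ω = true := by cases hc : χ ω <;> simp_all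
        exact (mem_s ωᶜ).2 ⟨hω'.compl, flip_true ω hω' h'⟩
    · intro ω hω ω' hω' heq
      change (if χ ω = false then ω else ωᶜ) = (if χ ω' = false then ω' else ω'ᶜ) at heq
      have hωb : ω ∈ badSet x c := hω
      have hω'b : ω' ∈ badSet x c := hω'
      by_cases h : χ ω = false <;> by_cases h' : χ ω' = false
      · rw [if_pos h, if_pos h'] at heq; exact heq
      · rw [if_pos h, if_neg h'] at heq
        -- ω = ω'ᶜ: then ω' = ωᶜ would be in badSet together with ω
        exfalso
        apply not_mem_badSet_compl hx hωb
        rw [heq, compl_compl]; exact hω'b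
      · rw [if_neg h, if_pos h'] at heq
        exfalso
        apply not_mem_badSet_compl hx hω'b
        rw [← heq, compl_compl]; exact hωb
      · rw [if_neg h, if_neg h'] at heq
        exact compl_injective heq
  rw [crossCount_eq_card_badSet, topBotCount_eq_card_goodSet]
  exact hbad.trans hsg

/-- **Abstract Lemma B with two cells** (the two-type case, graph-free): if only the cells `x a`
and `x b` occur on crossing points of a monotone `c`, then `crossCount x c ≤ topBotCount c`. -/
theorem crossCount_le_topBotCount_of_two_cells (x : Fin r → Setoid (Fin k))
    (hx : IsCrossingFamily x) (c : Config S → Setoid (Fin k)) (hc : Monotone c) (a b : Fin r)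
    (hab : ∀ ω : Config S, IsCrossingPt x c ω → c ω = x a ∨ c ω = x b) :
    crossCount x c ≤ topBotCount c := by
  classical
  refine crossCount_le_topBotCount_of_separating_colouring x hx.injective c
    (fun ω => decide (c ω = x a)) ?_ ?_
  · intro σ τ hσ hτ hne
    -- exactly one of `c σ`, `c τ` equals `x a`, the other is `x b` with `b ≠ a`
    have key : ∀ σ τ : Config S, IsCrossingPt x c τ → c σ = x a → c τ ≠ x a →
        c (σ ⊔ τ) = ⊤ ∧ c (σ ⊓ τ) = ⊥ := by
      intro σ τ hτ h1 h2
      have hτb : c τ = x b := (hab τ hτ).resolve_left h2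
      have hba : b ≠ a := by
        intro e; subst e; exact h2 hτb
      constructor
      · apply top_le_iff.1
        calc (⊤ : Setoid (Fin k)) = x a ⊔ x b := (hx.sup_eq_top hba.symm).symm
          _ = c σ ⊔ c τ := by rw [h1, hτb]
          _ ≤ c (σ ⊔ τ) := sup_le (hc le_sup_left) (hc le_sup_right)
      · apply le_bot_iff.1
        calc c (σ ⊓ τ) ≤ c σ ⊓ c τ := le_inf (hc inf_le_left) (hc inf_le_right)
          _ = x a ⊓ x b := by rw [h1, hτb]
          _ = ⊥ := hx.inf_eq_bot hba.symm
    by_cases h1 : c σ = x a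
    · have h2 : c τ ≠ x a := by
        intro h; apply hne; simp [h1, h]
      exact key σ τ hτ h1 h2
    · have h2 : c τ = x a := by
        by_contra h; apply hne; simp [h1, h]
      have := key τ σ hσ h2 h1
      rw [sup_comm σ τ, inf_comm σ τ]
      exact this
  · intro σ hσ
    obtain ⟨i, j, hij, h1, h2⟩ := hσ
    -- `c σ` and `c σᶜ` are distinct cells among `{x a, x b}`, so exactly one equals `x a`
    have hne : c σ ≠ c σᶜ := by
      rw [h1, h2]; exact fun e => hij (hx.injective e)
    rcases hab σ ⟨i, j, hij, h1, h2⟩ with ha | hb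
    · have : c σᶜ ≠ x a := by rw [← ha]; exact hne.symm
      simp [ha, this]
    · rcases hab σᶜ ⟨j, i, hij.symm, h2, by rw [compl_compl]; exact h1⟩ with ha' | hb'
      · have : c σ ≠ x a := by rw [← ha']; exact hne
        simp [this, ha']
      · exact absurd (hb.trans hb'.symm) hne

/-! ### Lemma B with a colouring defect

For an ARBITRARY two-colouring `χ` of the crossing points with `χ σ ≠ χ σᶜ` (no separation
hypothesis), Daykin's inequality still gives `crossCount² ≤ (topBotCount + |infDefect|) ·
(topBotCount + |supDefect|)`, where the **defects** are the joins (resp. meets) of differently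
coloured crossing points that are NOT `{⊤, ⊥}` antipodal pairs. With a separating colouring both
defects are empty and `crossCount_le_topBotCount_of_separating_colouring` is recovered; in general
`crossCount ≤ topBotCount + max |infDefect| |supDefect|` — the slack-carrying form of Lemma B for
maps whose graph `Γ` has an odd cycle (`HOME/proofs/P4-components.md` §8). -/

open Classical in
/-- The colour class `b` of the crossing points of `c` under `χ`. -/
noncomputable def colourClass (x : Fin r → Setoid (Fin k)) (c : Config S → Setoid (Fin k))
    (χ : Config S → Bool) (b : Bool) : Finset (Config S) :=
  univ.filter fun σ => IsCrossingPt x c σ ∧ χ σ = b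

open Classical in
/-- The **join defect** of `χ`: joins `σ ⊔ τ` of differently coloured crossing points that are not
`{⊤, ⊥}` antipodal pairs (`⊤`-member). -/
noncomputable def supDefect (x : Fin r → Setoid (Fin k)) (c : Config S → Setoid (Fin k))
    (χ : Config S → Bool) : Finset (Config S) :=
  (colourClass x c χ false ⊻ colourClass x c χ true) \ goodSet c

open Classical in
/-- The **meet defect** of `χ`: meets `σ ⊓ τ` of differently coloured crossing points that are not
`{⊤, ⊥}` antipodal pairs (`⊥`-member). -/
noncomputable def infDefect (x : Fin r → Setoid (Fin k)) (c : Config S → Setoid (Fin k))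
    (χ : Config S → Bool) : Finset (Config S) :=
  (colourClass x c χ false ⊼ colourClass x c χ true) \ (goodSet c).image compl

/-- **Lemma B with a colouring defect** (product form): for every two-colouring `χ` of the cube
giving every crossing point a colour different from its antipode's,
`crossCount² ≤ (topBotCount + |infDefect|) · (topBotCount + |supDefect|)`. -/
theorem crossCount_sq_le_of_colouring (x : Fin r → Setoid (Fin k))
    (hx : Function.Injective x) (c : Config S → Setoid (Fin k)) (χ : Config S → Bool)
    (hcross : ∀ σ : Config S, IsCrossingPt x c σ → χ σ ≠ χ σᶜ) :
    crossCount x c * crossCount x c ≤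
      (topBotCount c + (infDefect x c χ).card) * (topBotCount c + (supDefect x c χ).card) := by
  classical
  set s : Finset (Config S) := colourClass x c χ false with hs
  set t : Finset (Config S) := colourClass x c χ true with ht
  have mem_s : ∀ σ, σ ∈ s ↔ IsCrossingPt x c σ ∧ χ σ = false := by
    intro σ; rw [hs, colourClass, Finset.mem_filter]; simp
  have mem_t : ∀ σ, σ ∈ t ↔ IsCrossingPt x c σ ∧ χ σ = true := by
    intro σ; rw [ht, colourClass, Finset.mem_filter]; simp
  have flip_false : ∀ σ, IsCrossingPt x c σ → χ σ = false → χ σᶜ = true := by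
    intro σ hσ h
    cases h' : χ σᶜ
    · exact absurd (h.trans h'.symm) (hcross σ hσ)
    · rfl
  have flip_true : ∀ σ, IsCrossingPt x c σ → χ σ = true → χ σᶜ = false := by
    intro σ hσ h
    cases h' : χ σᶜ
    · rfl
    · exact absurd (h.trans h'.symm) (hcross σ hσ)
  have hts : t = s.image compl := by
    ext ω
    rw [mem_t, Finset.mem_image]
    constructor
    · rintro ⟨hω, hχ⟩
      exact ⟨ωᶜ, (mem_s ωᶜ).2 ⟨hω.compl, flip_true ω hω hχ⟩, compl_compl ω⟩
    · rintro ⟨σ, hσ, rfl⟩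
      obtain ⟨hσ, hχ⟩ := (mem_s σ).1 hσ
      exact ⟨hσ.compl, flip_false σ hσ hχ⟩
  have hcard : t.card = s.card := by
    rw [hts]; exact Finset.card_image_of_injective _ compl_injective
  -- the joins and meets, up to the defects, are `{⊤, ⊥}` pairs
  have hsups : (s ⊻ t).card ≤ (goodSet c).card + (supDefect x c χ).card := by
    have h1 : s ⊻ t ⊆ goodSet c ∪ supDefect x c χ := by
      rw [supDefect, Finset.union_sdiff_self_eq_union]
      exact Finset.subset_union_right
    exact (Finset.card_le_card h1).trans (Finset.card_union_le _ _)
  have hinfs : (s ⊼ t).card ≤ (goodSet c).card + (infDefect x c χ).card := by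
    have h1 : s ⊼ t ⊆ (goodSet c).image compl ∪ infDefect x c χ := by
      rw [infDefect, Finset.union_sdiff_self_eq_union]
      exact Finset.subset_union_right
    exact (Finset.card_le_card h1).trans
      ((Finset.card_union_le _ _).trans (Nat.add_le_add_right Finset.card_image_le _))
  -- Daykin
  have hdk := Finset.le_card_infs_mul_card_sups s t
  rw [hcard] at hdk
  -- `badSet` injects into `s`
  have hbad : (badSet x c).card ≤ s.card := by
    refine Finset.card_le_card_of_injOn (fun ω => if χ ω = false then ω else ωᶜ) ?_ ?_
    · intro ω hω
      have hω' := isCrossingPt_of_mem_badSet hω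
      show (if χ ω = false then ω else ωᶜ) ∈ s
      by_cases h : χ ω = false
      · rw [if_pos h]
        exact (mem_s ω).2 ⟨hω', h⟩
      · rw [if_neg h]
        have h' : χ ω = true := by cases hc : χ ω <;> simp_all
        exact (mem_s ωᶜ).2 ⟨hω'.compl, flip_true ω hω' h'⟩
    · intro ω hω ω' hω' heq
      change (if χ ω = false then ω else ωᶜ) = (if χ ω' = false then ω' else ω'ᶜ) at heq
      have hωb : ω ∈ badSet x c := hω
      have hω'b : ω' ∈ badSet x c := hω'
      by_cases h : χ ω = false <;> by_cases h' : χ ω' = false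
      · rw [if_pos h, if_pos h'] at heq; exact heq
      · rw [if_pos h, if_neg h'] at heq
        exfalso
        apply not_mem_badSet_compl hx hωb
        rw [heq, compl_compl]; exact hω'b
      · rw [if_neg h, if_pos h'] at heq
        exfalso
        apply not_mem_badSet_compl hx hω'b
        rw [← heq, compl_compl]; exact hωb
      · rw [if_neg h, if_neg h'] at heq
        exact compl_injective heq
  rw [crossCount_eq_card_badSet, topBotCount_eq_card_goodSet]
  calc (badSet x c).card * (badSet x c).card ≤ s.card * s.card := Nat.mul_le_mul hbad hbad
    _ ≤ (s ⊼ t).card * (s ⊻ t).card := hdk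
    _ ≤ ((goodSet c).card + (infDefect x c χ).card) *
        ((goodSet c).card + (supDefect x c χ).card) := Nat.mul_le_mul hinfs hsups

/-- **Lemma B with a colouring defect** (linear form): `crossCount ≤ topBotCount + max |infDefect|
|supDefect|` for every antipode-separating two-colouring of the crossing points. -/
theorem crossCount_le_topBotCount_add_defect (x : Fin r → Setoid (Fin k))
    (hx : Function.Injective x) (c : Config S → Setoid (Fin k)) (χ : Config S → Bool)
    (hcross : ∀ σ : Config S, IsCrossingPt x c σ → χ σ ≠ χ σᶜ) :
    crossCount x c ≤ topBotCount c + max (infDefect x c χ).card (supDefect x c χ).card := by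
  have h := crossCount_sq_le_of_colouring x hx c χ hcross
  set m := max (infDefect x c χ).card (supDefect x c χ).card with hm
  have h1 : (topBotCount c + (infDefect x c χ).card) ≤ topBotCount c + m :=
    Nat.add_le_add_left (le_max_left _ _) _
  have h2 : (topBotCount c + (supDefect x c χ).card) ≤ topBotCount c + m :=
    Nat.add_le_add_left (le_max_right _ _) _
  exact Nat.mul_self_le_mul_self_iff.1 (h.trans (Nat.mul_le_mul h1 h2))

end Colouring

end PercRepro
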